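import Literature.Algebra.Homology.OrderedCechSystemRefineMap
import Literature.Algebra.Homology.OrderedCechSystemRefineComp
import HarnessLib

/-!
# Refinement morphisms of ordered Čech complexes COMPOSE: `τ^♯ ≫ τ'^♯ = (τ ∘ τ')^♯` as morphisms of complexes and on classes
# (The Stacks Project, Tags 01FG, 01FP)

Layer `Algebra/Homology`, PROOF lane (theorems only; no definition, no instance, no notation, no named fact, no `sorry`).
Cell `hodgecm-mathlib` FLOOR 0, P1 sub-line F-11, packet (iv)∕J3, (G1) «pull-backs on classes», letter **(G1-c) class form**
(F0P1b-plan (g0) (R100); F0P1b-p02 (g2) «YES» 2026-08-31; B-p09 (g18)).  HC_CM is proved only modulo the 7 printed citations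
until rung 0 closes — nothing here bears on a summit statement.

★ `refineComplexMap τ φ : sysComplex M ⟶ sysComplex M'` (`OrderedCechSystemRefineMap`, F0P1b-p02 (g2)) packages the refinement of
ordered Čech cochains along an arbitrary index map; ★ `refineCochain_comp` (`OrderedCechSystemRefineComp`, B-p09 (g18)) says the
refinements compose ON COCHAINS for any composite datum `φc` characterised by `φc_{s''} = φ'_{s''} ∘ φ_{θ'(s'')} ∘ M(=)`.  Hence:

* **`refineComplexMap_comp`** — `refineComplexMap θ φ ≫ refineComplexMap θ' φ' = refineComplexMap (θ ∘ θ') φc` (equality of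
  morphisms of cochain complexes);
* **`homologyMap_refineComplexMap_comp`** — on classes, `H(θ'^♯) ∘ H(θ^♯) = H((θ ∘ θ')^♯)` in every degree
  (`(f ≫ g)^* = g^* ∘ f^*`: the composite-index-map identities `i₁^* m^* = 𝟙`, `sw^* p₁^* = p₂^*`, … of the F-J3b skeleton);
  elementwise `homologyMap_refineComplexMap_comp_apply`.

## References
* The Stacks Project, Tag 01FG (refinement maps of Čech complexes), Tag 01FP (their composites). [StacksProject]
* U. Görtz, T. Wedhorn, *Algebraic Geometry II* (2023), Def. 21.68 (p. 180). [GortzWedhorn2023]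
-/

universe v u

open CategoryTheory HomologicalComplex

set_option backward.isDefEq.respectTransparency false -- `ModuleCat`-valued functors (as in ★ `OrderedCechSystem`)

noncomputable section

namespace Literature.Algebra.Homology

namespace OrderedCech

variable {ι : Type} [LinearOrder ι] {ι' : Type} [LinearOrder ι'] {ι'' : Type} [LinearOrder ι''] {A : Type u} [CommRing A]
  {M : Finset ι ⥤ ModuleCat.{v} A} {M' : Finset ι' ⥤ ModuleCat.{v} A} {M'' : Finset ι'' ⥤ ModuleCat.{v} A}
  (θ : ι' → ι) (φ : imageFunctor θ ⋙ M ⟶ M') (θ' : ι'' → ι') (φ' : imageFunctor θ' ⋙ M' ⟶ M'')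
  (φc : imageFunctor (θ ∘ θ') ⋙ M ⟶ M'')
  (hφc : ∀ (s'' : Finset ι'') (x : M.obj (s''.image (θ ∘ θ'))),
    (φc.app s'').hom x = (φ'.app s'').hom ((φ.app (s''.image θ')).hom
      ((M.map (homOfLE (Finset.image_image.symm.le : s''.image (θ ∘ θ') ≤ (s''.image θ').image θ))).hom x)))

include hφc in
/-- **Refinement morphisms compose**: `refineComplexMap θ φ ≫ refineComplexMap θ' φ' = refineComplexMap (θ ∘ θ') φc` for any
composite datum `φc` characterised by `φc_{s''} = φ'_{s''} ∘ φ_{θ'(s'')} ∘ M(=)` (★ `refineCochain_comp` in every degree).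
[cite: StacksProject, Tag 01FP] [cite: StacksProject, Tag 01FG] -/
theorem refineComplexMap_comp :
    refineComplexMap θ φ ≫ refineComplexMap θ' φ' = refineComplexMap (M := M) (θ ∘ θ') φc := by
  ext n g
  change refineCochain θ' φ' n (refineCochain θ φ n g) = refineCochain (θ ∘ θ') φc n g
  exact refineCochain_comp θ φ θ' φ' φc hφc n g

include hφc in
/-- **On classes, refinements compose**: `H(θ'^♯)(H(θ^♯) x) = H((θ ∘ θ')^♯) x` in every degree — the functoriality
`(f ≫ g)^* = g^* f^*` of pull-backs on ordered Čech cohomology (used with `i₁ ≫ m = 𝟙`, `sw ≫ p₁ = p₂`, … in F-J3b).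
[cite: StacksProject, Tag 01FP] [cite: StacksProject, Tag 01FG] -/
theorem homologyMap_refineComplexMap_comp (n : ℤ) :
    HomologicalComplex.homologyMap (refineComplexMap θ φ) n ≫ HomologicalComplex.homologyMap (refineComplexMap θ' φ') n =
      HomologicalComplex.homologyMap (refineComplexMap (M := M) (θ ∘ θ') φc) n := by
  rw [← HomologicalComplex.homologyMap_comp, refineComplexMap_comp θ φ θ' φ' φc hφc]

include hφc in
/-- Elementwise form of `homologyMap_refineComplexMap_comp`. [cite: StacksProject, Tag 01FP] -/
theorem homologyMap_refineComplexMap_comp_apply (n : ℤ) (x : (sysComplex M).homology n) :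
    (HomologicalComplex.homologyMap (refineComplexMap θ' φ') n).hom
        ((HomologicalComplex.homologyMap (refineComplexMap θ φ) n).hom x) =
      (HomologicalComplex.homologyMap (refineComplexMap (θ ∘ θ') φc) n).hom x := by
  rw [← homologyMap_refineComplexMap_comp θ φ θ' φ' φc hφc n]
  rfl

include hφc in
/-- **Characterised form** (any packagings `F`, `F'`, `Fc` of the three refinements as cochain maps, e.g. other seats'
constructions): `H(F') ∘ H(F) = H(Fc)` on classes. [cite: StacksProject, Tag 01FP] -/
theorem homologyMap_comp_eq_of_refine (F : sysComplex M ⟶ sysComplex M') (F' : sysComplex M' ⟶ sysComplex M'')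
    (Fc : sysComplex M ⟶ sysComplex M'')
    (hF : ∀ (n : ℤ) (g : SysCochain M n), (F.f n).hom g = refineCochain θ φ n g)
    (hF' : ∀ (n : ℤ) (g : SysCochain M' n), (F'.f n).hom g = refineCochain θ' φ' n g)
    (hFc : ∀ (n : ℤ) (g : SysCochain M n), (Fc.f n).hom g = refineCochain (θ ∘ θ') φc n g) (n : ℤ) :
    HomologicalComplex.homologyMap F n ≫ HomologicalComplex.homologyMap F' n = HomologicalComplex.homologyMap Fc n := by
  have hcomp : F ≫ F' = Fc := by
    ext k g
    change (F'.f k).hom ((F.f k).hom g) = (Fc.f k).hom g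
    rw [hF, hF', hFc]
    exact refineCochain_comp θ φ θ' φ' φc hφc k g
  rw [← HomologicalComplex.homologyMap_comp, hcomp]

end OrderedCech

end Literature.Algebra.Homology

end
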